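import Literature.MathematicalPhysics.QuantumLattice.HubbardWave0
import HarnessLib

/-!
# Discharges for the Hubbard wave-0 named facts (`HubbardWave0`): the Fock vacuum

Family `hubbard` (trunk T-QLATTICE), statement hubbard.S04. Sibling proof file of
`Literature/MathematicalPhysics/QuantumLattice/HubbardWave0.lean`: it proves named facts
(`def X : Prop`, D-0014) of that file from Mathlib alone. No statement is introduced or changed
here.

Proved here:

* `Literature.Hubbard.annihilation_mulVec_vacuum_holds : annihilation_mulVec_vacuum` — every
  annihilation operator kills the vacuum, `c_i |∅⟩ = 0` (the defining property `a(f)Ω = 0` of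
  the Fock representation of the CAR; Bratteli–Robinson II §5.2.2). In the concrete model of
  `HubbardWave0` (`Fock ι = (Finset ι → ℂ)`, `vacuum = Pi.single ∅ 1`, `c_i` the Jordan–Wigner
  matrix `annihilation i`) this is a direct computation in the occupation basis: the `s`-th
  component of `c_i |∅⟩` is the matrix entry `(c_i)_{s,∅}`, which vanishes because
  `insert i s ≠ ∅`.

## Source

O. Bratteli, D. W. Robinson, *Operator Algebras and Quantum Statistical Mechanics 2*, 2nd ed.,
Springer (1997), §5.2.1–§5.2.2 (Fock space, annihilation and creation operators, the CAR
algebra and its Fock representation). Secondary: D. E. Evans, Y. Kawahigashi, *Quantum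
Symmetries on Operator Algebras*, OUP (1998), §4.8 p. 197 (Fock representation of the CAR).
-/

namespace Literature.MathematicalPhysics.QuantumLattice

open Matrix Finset

variable {ι : Type*} [LinearOrder ι] [Fintype ι]

/-- Discharge of `annihilation_mulVec_vacuum`: the vacuum is annihilated by every annihilation
operator, `c_i |∅⟩ = 0`. Direct computation in the occupation basis: the only basis vector in the
support of `|∅⟩ = Pi.single ∅ 1` is `∅`, and the matrix entry `(c_i)_{s,∅}` vanishes because
`insert i s ≠ ∅`. Bratteli–Robinson II §5.2.2 (Fock representation of the CAR: `a(f)Ω = 0`);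
see also Evans–Kawahigashi (1998) §4.8 p. 197. [cite: BratteliRobinsonII1997, §5.2.2] -/
theorem annihilation_mulVec_vacuum_holds : annihilation_mulVec_vacuum (ι := ι) := by
  intro i
  ext s
  have h : (∅ : Finset ι) ≠ insert i s := (Finset.insert_ne_empty i s).symm
  simp [vacuum, annihilation, Matrix.mulVec, dotProduct, Pi.single_apply, h]

end Literature.MathematicalPhysics.QuantumLattice
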